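import Summits.QuantumAdvantage.QuantumAdvantage.Theses.RingFrame
import Summits.QuantumAdvantage.AdviceFreeQNC0.ProductGame
import Summits.QuantumAdvantage.AdviceFreeQNC0.CrossToProduct
import Summits.QuantumAdvantage.AdviceFreeQNC0.CrossTeam
import Summits.QuantumAdvantage.AdviceFreeQNC0.WalkTransport
import Summits.QuantumAdvantage.AdviceFreeQNC0.EliminationHardness
import HarnessLib

/-!
# Route RingFrame, crux α `RingToElim` (stmt-QuantumAdvantage-19119): objects of the registered line `product`

The five proposition NAMES of the registered skeleton `Cruxes/RingToElim/Lines/product.lean`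
(skeleton sha `5e71642efee1`, `ledger skeleton check` 2026-08-26T07:36Z; stubs `stub_LDMA`,
`stub_product`, `stub_crossToProduct`, `stub_embed`, `stub_transport`), with bodies VERBATIM from the
skeleton, so that the stub files of this crux (`RingFrameRingToElimStubs.lean`, …) can state the
registered stubs under their registered names AND signatures
(`stub_transport : RingHardU → Summit.QuantumAdvantage.AdviceFreeQNC0.RingHard 2`, …):

* `RingHardU` — the ring crux in walk coordinates (charge `n + 2`);
* `CrossTeamHardPolylog` — hardness of the two-member cross-team game at polylog cross-degree;
* `ElimHard` — the crux's antecedent (two-bit elimination hardness), a THEOREM of the cell topic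
  (`elimHard`, `EliminationHardness.lean`; witness `elimHard_holds` below);
* `ProductHardPolylog` — the `(L, L')` product game loses a positive fraction of cells;
* `LDMAPolylog` — weighted residue non-avoidance for column-low-degree maps (the line's one OPEN,
  load-bearing stub `stub_LDMA`; for separable maps it is the theorem `ldmaPolylog_separable`).

The vocabulary inside the bodies (`HasDeg`, `wt`, `ringWinU`, `T4`, `CrossDeg`, `crossWinCount`,
`IsElimWin`, `agreeCountR`, `distFail`) is the cell topic's (`Summits/QuantumAdvantage/AdviceFreeQNC0/`,
namespace `Summit.QuantumAdvantage.AdviceFreeQNC0`), token-identical to the skeleton's own copies.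
Route-posited objects live in a `…Defs.lean` file (CONVENTIONS §1/§6), never in a proof file.

WHAT THIS IS NOT: definitions only; nothing is claimed about `RingHardU`, `CrossTeamHardPolylog`,
`ProductHardPolylog`, `LDMAPolylog` (all open; each implies the crux).
-/

-- the sub-problem namespace `Summit.QuantumAdvantage.QuantumAdvantage` repeats the summit name by design (D-0017)
set_option linter.dupNamespace false

namespace Summit.QuantumAdvantage.QuantumAdvantage.Theorems.RingToElim

open Finset Summit.QuantumAdvantage.AdviceFreeQNC0
open Literature.Computability.MetaComplexity.Smolensky

noncomputable section

/-! ### The five proposition names of line `product` (bodies verbatim from the registered skeleton) -/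

/-- **RingHardU** — the ring crux in walk coordinates at the trace-form charge `c = n + 2`
(registered skeleton `Lines/product.lean`, verbatim). -/
def RingHardU : Prop :=
  ∃ θ : ℝ, θ < 1 ∧ ∀ C : ℕ, ∃ n₀ : ℕ, ∀ n ≥ n₀, ∀ y : Fin (n + 1) → (Fin n → Bool) → Bool,
    (∀ g, HasDeg (y g) ((Nat.log 2 n) ^ C)) →
      ((univ.filter fun u : Fin n → Bool => ringWinU (n + 2) y u = true).card : ℝ) ≤ θ * (2 : ℝ) ^ n

/-- **CrossTeamHardPolylog** — hardness of the cross-team game at polylog cross-degree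
(registered skeleton `Lines/product.lean` = line `tensor`, verbatim). -/
def CrossTeamHardPolylog : Prop :=
  ∃ θ : ℝ, θ < 1 ∧ ∀ C : ℕ, ∃ L₀ : ℕ, ∀ L L' : ℕ, L₀ ≤ L → L₀ ≤ L' →
    ∀ c : ℕ, ∀ F₀ : (Fin L → Bool) → (Fin L' → Bool) → T4, ∀ F₁ : (Fin L' → Bool) → (Fin L → Bool) → T4,
      CrossDeg ((Nat.log 2 (min L L')) ^ C) F₀ → CrossDeg ((Nat.log 2 (min L L')) ^ C) F₁ →
        (crossWinCount c F₀ F₁ : ℝ) ≤ θ * (2 : ℝ) ^ (L + L')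

/-- **ElimHard** — the elimination-hardness hypothesis `E` of the crux (= the antecedent of
`RingFrame.RingToElim`, verbatim; a THEOREM of the cell topic: `elimHard`, `EliminationHardness.lean`). -/
def ElimHard : Prop := ∃ η₀ : ℝ, 0 < η₀ ∧ ∀ C : ℕ, ∃ n₀ : ℕ, ∀ n ≥ n₀, ∀ a b : Literature.Computability.MetaComplexity.Smolensky.CubeFn (ZMod 2) n, a ∈ Literature.Computability.MetaComplexity.Smolensky.lowDeg (ZMod 2) n ((Nat.log 2 n) ^ C) → b ∈ Literature.Computability.MetaComplexity.Smolensky.lowDeg (ZMod 2) n ((Nat.log 2 n) ^ C) → ∀ dec : ZMod 2 → ZMod 2 → ℕ, η₀ * (2 : ℝ) ^ n ≤ ((Finset.univ.filter fun u : Fin n → Bool => dec (a u) (b u) % 3 = Literature.Computability.MetaComplexity.Hegedus.wt u % 3).card : ℝ)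

/-- **ProductHardPolylog** — the `(L, L')` product game at polylog degree loses a positive fraction
of cells (registered skeleton `Lines/product.lean`, verbatim). -/
def ProductHardPolylog : Prop :=
  ∃ μ : ℝ, 0 < μ ∧ ∀ C : ℕ, ∃ L₀ : ℕ, ∀ L L' : ℕ, L₀ ≤ L → L₀ ≤ L' →
    ∀ X Y : (Fin L → Bool) → (Fin L' → Bool) → Bool,
      (∀ v, IsElimWin ((Nat.log 2 (min L L')) ^ C) (fun u => X u v)) →
      (∀ u, IsElimWin ((Nat.log 2 (min L L')) ^ C) (fun v => Y u v)) →
        μ * (2 : ℝ) ^ (L + L') ≤ (agreeCountR X Y : ℝ)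

/-- **LDMAPolylog** — weighted residue non-avoidance for column-low-degree maps (the LOAD-BEARING
stub of line `product`, OPEN; registered skeleton `Lines/product.lean`, verbatim). -/
def LDMAPolylog : Prop :=
  ∃ κ : ℝ, 0 < κ ∧ ∀ C : ℕ, ∃ L₀ : ℕ, ∀ L L' : ℕ, L₀ ≤ L → L₀ ≤ L' → ∀ D : ℕ, D ≤ (Nat.log 2 (min L L')) ^ C →
    ∀ Γ : (Fin L → Bool) → (Fin L' → Bool) → Bool, (∀ v, HasDeg (fun u => Γ u v) D) → ∀ r : ℕ,
      κ * ((∑ u : Fin L → Bool, distFail D (Γ u) : ℕ) : ℝ) ≤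
        ((∑ u ∈ univ.filter (fun u : Fin L → Bool => wt u % 3 = r % 3), distFail D (Γ u) : ℕ) : ℝ)

/-- `ElimHard` HOLDS: the cell topic's theorem `elimHard` (Srinivasan's robust Hegedűs lemma ⟹
sparse residue avoidance ⟹ two-bit elimination hardness at polylog degree). -/
theorem elimHard_holds : ElimHard := elimHard

end

end Summit.QuantumAdvantage.QuantumAdvantage.Theorems.RingToElim
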